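import Mathlib
import Literature.NumberTheory.Irrationality.Zudilin2003.CatalanRemarksTheorem1
import HarnessLib

/-!
# Catalan box family — Zudilin's SECOND construction (12)–(13): residues, certificate, and `ũ_n` as a residue sum

HONEST FRAMING: systematic search; no irrationality claim unless certified.  Exact identities between explicitly defined
rational numbers; nothing in this file is a statement about Catalan's constant.

Cell `pub-zeta5`, planner seat `fam-catalan` (gen 8), kernel target K-vT-odd, file 1 of 5.  Zudilin, *A few remarks on
linear forms involving Catalan's constant*, arXiv:math/0210423 [Zudilin2002CatalanRemarks], Theorem 2: the series (12)
`ũ_n G − ṽ_n = −Σ_{ν≥1} R̃_n′(ν)` with the rational function `R̃_n` (tree: `Zudilin2003.RT`) and the recursion (13) (tree: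
`Zudilin2003.IsSolutionT`, `uT = solT 0 6`, `vT = solT (−1) 5`).  The print proves (13) by "Zeilberger's algorithm of
creative telescoping" without displaying the certificate, and the inclusions (14) by "a word-by-word repetition" of Sect. 1.
This file supplies the DATA of that repetition, in the pattern of the tree's treatment of the FIRST construction
(`Literature/…/Zudilin2003/CatalanRemarksTheorem1.lean`, namespace `Zudilin2003.Remarks`, whose `invFac`, `pole`, `xq`,
`wsum`, `kap` are reused BY NAME):
* `resRT n k` — the residues of `R̃_n` at its poles `P_k = (2k+1)/4`, `−n ≤ k ≤ n`, in closed form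
  `(−1)^k (n/4)·binom(2n, n+k)·binom(P_k−1, n−1)·binom(P_k−1, n)` (zero off the window through `invFac`);
* `certPT` — an explicit creative-telescoping certificate `σ̃_n(t) = (4t+2n−1)·P̃(n,t)/(2n(2n−1)(4t−2n−3))`, `P̃` an
  integer polynomial of degree `8` in `n` and `2` in `t`, found for this file by exact rational linear algebra (seat folder
  `kV/find_cert.py`, `check_cert.py`: the residue identity below verified for `n ≤ 40` before typing), and `telT n k` — the
  residues of the telescoper `S̃_n = σ̃_n R̃_n` in closed form (the uniform formula covers the extra pole `P_{n+1}` of `σ̃_n`);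
* `dataIdentityT` — the pointwise certificate identity: with the coefficients of (13) at index `n = m+2`,
  `A(n)·resRT (n+1) k − q̃(n)·resRT n k − C(n)·resRT (n−1) k = telT n (k+2) − telT n k` for ALL `k ∈ ℤ` (one `ring` after
  normalising the factorial / binomial atoms);
* `UresT n := −8·Σ_k (−1)^k resRT n k` solves (13) (`UresT_isSolutionT`; shift invariance of the alternating window sum) and
  **`uT_eq_UresT : Zudilin2003.uT n = UresT n`** for every `n` (same recursion, same initial values `0, 6`) — the analogue
  of (10) for the second construction;
* `VresT n := −Σ_k resRT n k·κ(k)` solves (13) up to the inhomogeneity `BsumT n = Σ_k telT n k/(1−P_k)²` (`VresT_rec`); that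
  `BsumT n = 0` for `n ≥ 2` (it is `516 ≠ 0` at `n = 1`: `R̃_1` has only a simple zero at `t = 1`) and `vT n = VresT n` for
  `n ≥ 1` are the business of files 2–3 `CatalanRemarksVTLagrange` / `CatalanRemarksVTIdentification`; the denominators, of files
  4–5 `CatalanRemarksVTDenominator` / `CatalanRemarksTInclusions`.
Analytically `resRT`/`UresT`/`VresT` are what the partial fractions of (12) produce (`−Σ_ν R̃_n′(ν) = Σ_k resRT n k·Σ_ν (ν−P_k)⁻²`
and `Σ_{ν≥1} 16/(4ν−2k−1)² = π² − (−1)^k·8G + κ(k)`), but NO analytic statement is made or used here: the identification with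
`ũ_n`, `ṽ_n` goes through the recursion (13) and uniqueness (`IsSolutionT.ext_of_init`), exactly as in the template.
-/

namespace Summit.KontsevichZagierPeriods.Zeta5Search.CatalanRemarksVT

open Finset
open Literature.NumberTheory.Irrationality.Zudilin2003
  (pT qT IsSolutionT solT uT vT uT_two vT_two solT_isSolutionT leadT_pos)
open Literature.NumberTheory.Irrationality.Zudilin2003.Remarks
  (invFac invFac_natCast invFac_of_neg invFac_eq_succ_mul pole xq wsum wsum_succ wsum_of_support wsum_shift_two
    wsum_lin3 wsum_neg wsum_sub kap kap_rec kap_sub)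
open Literature.NumberTheory.Irrationality.KrattenthalerRivoal2008
  (gbinom gbinom_succ gbinom_succ_succ gbinom_zero gbinom_one)

/-! ### Closed-form residue data of the rational function (12) -/

/-- **The residues of `R̃_n` (12) in closed form**, uniformly in `k ∈ ℤ`:
`resRT n k = (−1)^k (n/4)·(2n)!·invFac(n+k)·invFac(n−k)·binom(x_k, n−1)·binom(x_k, n)`, `x_k = P_k − 1 = (2k−3)/4`
(zero unless `−n ≤ k ≤ n`; identically zero at `n = 0`).  [cite: Zudilin2002CatalanRemarks, Sect. 2, eq. (12)] -/
def resRT (n : ℕ) (k : ℤ) : ℚ :=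
  (-1) ^ k * ((n : ℚ) / 4) * ((2 * n).factorial : ℚ) * invFac ((n : ℤ) + k) * invFac ((n : ℤ) - k)
    * gbinom (xq k) (n - 1) * gbinom (xq k) n

/-- The polynomial part `P̃(n,t)` of the creative-telescoping certificate for (12) against (13) (found for this file;
the source invokes Zeilberger's algorithm without printing a certificate).
[cite: Zudilin2002CatalanRemarks, Sect. 2, Theorem 2 ("Zeilberger's algorithm of creative telescoping")] -/
def certPT (n t : ℚ) : ℚ :=
  (-9280 * n ^ 8 - 11200 * n ^ 7 + 13648 * n ^ 6 + 10416 * n ^ 5 - 5004 * n ^ 4 - 2012 * n ^ 3 - 33 * n ^ 2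
      + 27 * n)
    + (26240 * n ^ 7 - 960 * n ^ 6 - 29024 * n ^ 5 - 848 * n ^ 4 + 7896 * n ^ 3 + 1244 * n ^ 2 - 138 * n - 27) * t
    + (-14080 * n ^ 6 + 8320 * n ^ 5 + 11968 * n ^ 4 - 6016 * n ^ 3 - 1680 * n ^ 2 + 120 * n + 36) * t ^ 2

/-- **The residues of the telescoper** `S̃_n = σ̃_n R̃_n`, `σ̃_n(t) = (4t+2n−1)P̃(n,t)/(2n(2n−1)(4t−2n−3))`, in closed
form, uniformly in `k ∈ ℤ` (support `−n < k ≤ n+1`; at `k = n+1` this is the residue at the extra pole of `σ̃_n`).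
[cite: Zudilin2002CatalanRemarks, Sect. 2, Theorem 2] -/
def telT (n : ℕ) (k : ℤ) : ℚ :=
  -(((n : ℚ) + k) * certPT n (pole k) / (8 * (2 * (n : ℚ) - 1))) *
    ((-1) ^ k * ((2 * n).factorial : ℚ) * invFac ((n : ℤ) + k) * invFac ((n : ℤ) + 1 - k)
      * gbinom (xq k) (n - 1) * gbinom (xq k) n)

/-- **The pointwise certificate identity** (creative telescoping, residue by residue): with the coefficients of (13)
at `n = m+2`, `(2n)²(2n+1)²p̃(n)·resRT (n+1) k − q̃(n)·resRT n k − (2n)²(2n+1)(2n−3)p̃(n+1)·resRT (n−1) k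
= telT n (k+2) − telT n k` for ALL `k ∈ ℤ`. [cite: Zudilin2002CatalanRemarks, Sect. 2, Theorem 2, eq. (13)] -/
theorem dataIdentityT (m : ℕ) (k : ℤ) :
    (2 * ((m : ℚ) + 2)) ^ 2 * (2 * ((m : ℚ) + 2) + 1) ^ 2 * pT ((m : ℚ) + 2) * resRT (m + 3) k
      - qT ((m : ℚ) + 2) * resRT (m + 2) k
      - (2 * ((m : ℚ) + 2)) ^ 2 * (2 * ((m : ℚ) + 2) + 1) * (2 * ((m : ℚ) + 2) - 3) * pT ((m : ℚ) + 2 + 1)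
          * resRT (m + 1) k
    = telT (m + 2) (k + 2) - telT (m + 2) k := by
  have hm1 : ((m : ℚ) + 1) ≠ 0 := by positivity
  have hm2 : ((m : ℚ) + 2) ≠ 0 := by positivity
  have hm3 : ((m : ℚ) + 3) ≠ 0 := by positivity
  have h2m3 : (2 * ((m : ℚ) + 2) - 1) ≠ 0 := by
    have : (0 : ℚ) ≤ m := Nat.cast_nonneg m
    intro h; linarith
  -- the sign `(−1)^{k+2} = (−1)^k`
  have sgn : ((-1 : ℚ)) ^ (k + 2) = (-1) ^ k := by
    rw [zpow_add₀ (by norm_num : (-1 : ℚ) ≠ 0)]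
    norm_num
  -- factorials in terms of `(2m+2)!`
  have f6 : ((2 * (m + 3)).factorial : ℚ) =
      (2 * m + 3) * (2 * m + 4) * (2 * m + 5) * (2 * m + 6) * ((2 * (m + 1)).factorial : ℚ) := by
    rw [show 2 * (m + 3) = 2 * (m + 1) + 1 + 1 + 1 + 1 by ring]
    simp only [Nat.factorial_succ]
    push_cast
    ring
  have f4 : ((2 * (m + 2)).factorial : ℚ) = (2 * m + 3) * (2 * m + 4) * ((2 * (m + 1)).factorial : ℚ) := by
    rw [show 2 * (m + 2) = 2 * (m + 1) + 1 + 1 by ring]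
    simp only [Nat.factorial_succ]
    push_cast
    ring
  -- `invFac` atoms, family `n+k` (base `invFac (m+k+4)`)
  have a1 : invFac (((m + 3 : ℕ) : ℤ) + k) = (((m : ℤ) + k + 4 : ℤ) : ℚ) * invFac ((m : ℤ) + k + 4) :=
    invFac_eq_succ_mul _ _ (by omega)
  have a2 : invFac (((m + 2 : ℕ) : ℤ) + k) =
      (((m : ℤ) + k + 3 : ℤ) : ℚ) * ((((m : ℤ) + k + 4 : ℤ) : ℚ) * invFac ((m : ℤ) + k + 4)) := by
    rw [invFac_eq_succ_mul _ ((m : ℤ) + k + 3) (by omega),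
      invFac_eq_succ_mul ((m : ℤ) + k + 3) ((m : ℤ) + k + 4) (by ring)]
  have a3 : invFac (((m + 1 : ℕ) : ℤ) + k) = (((m : ℤ) + k + 2 : ℤ) : ℚ) *
      ((((m : ℤ) + k + 3 : ℤ) : ℚ) * ((((m : ℤ) + k + 4 : ℤ) : ℚ) * invFac ((m : ℤ) + k + 4))) := by
    rw [invFac_eq_succ_mul _ ((m : ℤ) + k + 2) (by omega),
      invFac_eq_succ_mul ((m : ℤ) + k + 2) ((m : ℤ) + k + 3) (by ring),
      invFac_eq_succ_mul ((m : ℤ) + k + 3) ((m : ℤ) + k + 4) (by ring)]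
  have a4 : invFac (((m + 2 : ℕ) : ℤ) + (k + 2)) = invFac ((m : ℤ) + k + 4) := by
    rw [show (((m + 2 : ℕ) : ℤ) + (k + 2)) = (m : ℤ) + k + 4 by omega]
  -- `invFac` atoms, families `n−k`, `n+1−k` (base `invFac (m+3−k)`)
  have b1 : invFac (((m + 3 : ℕ) : ℤ) - k) = invFac ((m : ℤ) + 3 - k) := by
    rw [show (((m + 3 : ℕ) : ℤ) - k) = (m : ℤ) + 3 - k by omega]
  have b2 : invFac (((m + 2 : ℕ) : ℤ) - k) = (((m : ℤ) + 3 - k : ℤ) : ℚ) * invFac ((m : ℤ) + 3 - k) :=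
    invFac_eq_succ_mul _ _ (by omega)
  have b3 : invFac (((m + 1 : ℕ) : ℤ) - k) =
      (((m : ℤ) + 2 - k : ℤ) : ℚ) * ((((m : ℤ) + 3 - k : ℤ) : ℚ) * invFac ((m : ℤ) + 3 - k)) := by
    rw [invFac_eq_succ_mul _ ((m : ℤ) + 2 - k) (by omega),
      invFac_eq_succ_mul ((m : ℤ) + 2 - k) ((m : ℤ) + 3 - k) (by ring)]
  have b4 : invFac (((m + 2 : ℕ) : ℤ) + 1 - k) = invFac ((m : ℤ) + 3 - k) := by
    rw [show (((m + 2 : ℕ) : ℤ) + 1 - k) = (m : ℤ) + 3 - k by omega]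
  have b5 : invFac (((m + 2 : ℕ) : ℤ) + 1 - (k + 2)) =
      (((m : ℤ) + 2 - k : ℤ) : ℚ) * ((((m : ℤ) + 3 - k : ℤ) : ℚ) * invFac ((m : ℤ) + 3 - k)) := by
    rw [invFac_eq_succ_mul _ ((m : ℤ) + 2 - k) (by omega),
      invFac_eq_succ_mul ((m : ℤ) + 2 - k) ((m : ℤ) + 3 - k) (by ring)]
  -- `gbinom` atoms in terms of `γ = binom(x_k, m)`
  have g1 : gbinom (xq k) (m + 1) = gbinom (xq k) m * (xq k - m) / ((m : ℚ) + 1) := by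
    rw [eq_div_iff hm1]; exact gbinom_succ (xq k) m
  have g2 : gbinom (xq k) (m + 2) =
      gbinom (xq k) m * (xq k - m) * (xq k - m - 1) / (((m : ℚ) + 1) * ((m : ℚ) + 2)) := by
    rw [eq_div_iff (mul_ne_zero hm1 hm2)]
    have h := gbinom_succ (xq k) (m + 1)
    push_cast at h
    rw [g1] at h
    field_simp at h
    linear_combination h
  have g3 : gbinom (xq k) (m + 3) = gbinom (xq k) m * (xq k - m) * (xq k - m - 1) * (xq k - m - 2)
      / (((m : ℚ) + 1) * ((m : ℚ) + 2) * ((m : ℚ) + 3)) := by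
    rw [eq_div_iff (mul_ne_zero (mul_ne_zero hm1 hm2) hm3)]
    have h := gbinom_succ (xq k) (m + 2)
    push_cast at h
    rw [g2] at h
    field_simp at h
    linear_combination h
  have g4 : gbinom (xq (k + 2)) (m + 1) = gbinom (xq k) m * (xq k + 1) / ((m : ℚ) + 1) := by
    have hx : xq (k + 2) = xq k + 1 := by unfold xq; push_cast; ring
    rw [hx, eq_div_iff hm1]
    exact gbinom_succ_succ (xq k) m
  have g5 : gbinom (xq (k + 2)) (m + 2) = gbinom (xq k) m * (xq k - m) * (xq k + 1)
      / (((m : ℚ) + 1) * ((m : ℚ) + 2)) := by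
    have hx : xq (k + 2) = xq k + 1 := by unfold xq; push_cast; ring
    rw [hx, eq_div_iff (mul_ne_zero hm1 hm2)]
    have h := gbinom_succ_succ (xq k) (m + 1)
    push_cast at h
    rw [g1] at h
    field_simp at h
    linear_combination h
  simp only [resRT, telT, show m + 3 - 1 = m + 2 from rfl, show m + 2 - 1 = m + 1 from rfl,
    show m + 1 - 1 = m from rfl]
  rw [sgn, f6, f4, a1, a2, a3, a4, b1, b2, b3, b4, b5, g1, g2, g3, g4, g5]
  unfold certPT pole xq pT qT
  push_cast
  field_simp
  ring

/-! ### Supports -/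

/-- `resRT n k = 0` for `k < −n`. [cite: Zudilin2002CatalanRemarks, Sect. 2, eq. (12)] -/
theorem resRT_eq_zero_of_lt (n : ℕ) (k : ℤ) (h : (n : ℤ) + k < 0) : resRT n k = 0 := by
  simp [resRT, invFac_of_neg h]

/-- `resRT n k = 0` for `k > n`. [cite: Zudilin2002CatalanRemarks, Sect. 2, eq. (12)] -/
theorem resRT_eq_zero_of_gt (n : ℕ) (k : ℤ) (h : (n : ℤ) - k < 0) : resRT n k = 0 := by
  simp [resRT, invFac_of_neg h]

/-- `telT n k = 0` for `k ≤ −n`. [cite: Zudilin2002CatalanRemarks, Sect. 2, Theorem 2] -/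
theorem telT_eq_zero_of_le (n : ℕ) (k : ℤ) (h : (n : ℤ) + k ≤ 0) : telT n k = 0 := by
  rcases h.lt_or_eq with h | h
  · simp [telT, invFac_of_neg h]
  · have h' : ((n : ℚ) + k) = 0 := by exact_mod_cast h
    simp [telT, h']

/-- `telT n k = 0` for `k > n+1`. [cite: Zudilin2002CatalanRemarks, Sect. 2, Theorem 2] -/
theorem telT_eq_zero_of_gt (n : ℕ) (k : ℤ) (h : (n : ℤ) + 1 - k < 0) : telT n k = 0 := by
  simp [telT, invFac_of_neg h]

/-! ### `ũ_n` as the alternating residue sum: the analogue of (10) for the second construction -/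

/-- `Ũ_n := −8·Σ_{k=−n}^{n} (−1)^k resRT n k` (window `|k| ≤ n` = support). [cite: Zudilin2002CatalanRemarks, Sect. 2, eq. (12)] -/
def UresT (n : ℕ) : ℚ := -8 * wsum n (fun k => (-1) ^ k * resRT n k)

/-- Any window `|k| ≤ N`, `N ≥ n`, computes `Ũ_n`. [cite: Zudilin2002CatalanRemarks, Sect. 2, eq. (12)] -/
theorem UresT_window (n N : ℕ) (hN : n ≤ N) : -8 * wsum N (fun k => (-1) ^ k * resRT n k) = UresT n := by
  unfold UresT
  congr 1
  refine wsum_of_support n _ (fun k hk => ?_) N hN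
  rcases hk with hk | hk
  · rw [resRT_eq_zero_of_gt n k (by omega), mul_zero]
  · rw [resRT_eq_zero_of_lt n k (by omega), mul_zero]

/-- **`Ũ_n` solves (13) from `n = 2` on** (sum the certificate identity against `(−1)^k`; the alternating window sum of the
telescoper is shift invariant). [cite: Zudilin2002CatalanRemarks, Sect. 2, Theorem 2, eq. (13)] -/
theorem UresT_rec (m : ℕ) :
    (2 * ((m : ℚ) + 2)) ^ 2 * (2 * ((m : ℚ) + 2) + 1) ^ 2 * pT ((m : ℚ) + 2) * UresT (m + 3)
      - qT ((m : ℚ) + 2) * UresT (m + 2)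
      - (2 * ((m : ℚ) + 2)) ^ 2 * (2 * ((m : ℚ) + 2) + 1) * (2 * ((m : ℚ) + 2) - 3) * pT ((m : ℚ) + 2 + 1)
          * UresT (m + 1) = 0 := by
  rw [← UresT_window (m + 3) (m + 3) le_rfl, ← UresT_window (m + 2) (m + 3) (by omega),
    ← UresT_window (m + 1) (m + 3) (by omega)]
  have key : (fun k => (2 * ((m : ℚ) + 2)) ^ 2 * (2 * ((m : ℚ) + 2) + 1) ^ 2 * pT ((m : ℚ) + 2)
        * ((-1) ^ k * resRT (m + 3) k) - qT ((m : ℚ) + 2) * ((-1) ^ k * resRT (m + 2) k)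
        - (2 * ((m : ℚ) + 2)) ^ 2 * (2 * ((m : ℚ) + 2) + 1) * (2 * ((m : ℚ) + 2) - 3) * pT ((m : ℚ) + 2 + 1)
          * ((-1) ^ k * resRT (m + 1) k))
      = fun k => (fun j => (-1 : ℚ) ^ j * telT (m + 2) j) (k + 2) - (-1) ^ k * telT (m + 2) k := by
    funext k
    have sgn : ((-1 : ℚ)) ^ (k + 2) = (-1) ^ k := by
      rw [zpow_add₀ (by norm_num : (-1 : ℚ) ≠ 0)]
      norm_num
    simp only [sgn]
    linear_combination (-1 : ℚ) ^ k * dataIdentityT m k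
  have step : (2 * ((m : ℚ) + 2)) ^ 2 * (2 * ((m : ℚ) + 2) + 1) ^ 2 * pT ((m : ℚ) + 2)
        * (-8 * wsum (m + 3) (fun k => (-1) ^ k * resRT (m + 3) k))
      - qT ((m : ℚ) + 2) * (-8 * wsum (m + 3) (fun k => (-1) ^ k * resRT (m + 2) k))
      - (2 * ((m : ℚ) + 2)) ^ 2 * (2 * ((m : ℚ) + 2) + 1) * (2 * ((m : ℚ) + 2) - 3) * pT ((m : ℚ) + 2 + 1)
        * (-8 * wsum (m + 3) (fun k => (-1) ^ k * resRT (m + 1) k))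
      = -8 * (wsum (m + 3) (fun k => (fun j => (-1 : ℚ) ^ j * telT (m + 2) j) (k + 2))
          - wsum (m + 3) (fun k => (-1) ^ k * telT (m + 2) k)) := by
    rw [← wsum_sub, ← key, ← wsum_lin3]
    ring
  rw [step, wsum_shift_two (m + 3) (by omega) (fun j => (-1 : ℚ) ^ j * telT (m + 2) j), sub_self, mul_zero]
  · exact mul_eq_zero_of_right _ (telT_eq_zero_of_gt (m + 2) _ (by push_cast; omega))
  · exact mul_eq_zero_of_right _ (telT_eq_zero_of_gt (m + 2) _ (by push_cast; omega))
  · exact mul_eq_zero_of_right _ (telT_eq_zero_of_le (m + 2) _ (by push_cast; omega))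
  · exact mul_eq_zero_of_right _ (telT_eq_zero_of_le (m + 2) _ (by push_cast; omega))

/-- `Ũ_0 = 0` (the residue data vanish identically at `n = 0`). [cite: Zudilin2002CatalanRemarks, Sect. 2, Theorem 2] -/
theorem UresT_zero : UresT 0 = 0 := by
  norm_num [UresT, wsum, resRT]

/-- `Ũ_1 = 6` (`resRT 1 (−1, 0, 1) = 5/16, −3/8, 1/16`). [cite: Zudilin2002CatalanRemarks, Sect. 2, eq. (12)] -/
theorem UresT_one : UresT 1 = 6 := by
  norm_num [UresT, wsum, Finset.sum_range_succ, resRT, invFac, xq, gbinom]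
  norm_num [show Int.toNat 2 = 2 from rfl, Nat.factorial]

/-- `Ũ_2 = 115/2 = ũ_2`. [cite: Zudilin2002CatalanRemarks, Sect. 2, eq. (13)] -/
theorem UresT_two : UresT 2 = 115 / 2 := by
  norm_num [UresT, wsum, Finset.sum_range_succ, resRT, invFac, xq, gbinom, Finset.prod_range_succ]
  norm_num [show Int.toNat 4 = 4 from rfl, show Int.toNat 3 = 3 from rfl, show Int.toNat 2 = 2 from rfl,
    Nat.factorial]

/-- **`Ũ` solves (13)** (at `n = 1` by the values `Ũ_0, Ũ_1, Ũ_2`; from `n = 2` on by `UresT_rec`).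
[cite: Zudilin2002CatalanRemarks, Sect. 2, Theorem 2, eq. (13)] -/
theorem UresT_isSolutionT : IsSolutionT UresT := by
  intro n hn
  rcases Nat.lt_or_ge n 2 with h | h
  · obtain rfl : n = 1 := by omega
    rw [show (1 : ℕ) + 1 = 2 from rfl, show (1 : ℕ) - 1 = 0 from rfl, UresT_two, UresT_one, UresT_zero]
    norm_num [pT, qT]
  · obtain ⟨m, rfl⟩ : ∃ m, n = m + 2 := ⟨n - 2, by omega⟩
    simp only [show m + 2 + 1 = m + 3 from rfl, show m + 2 - 1 = m + 1 from rfl]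
    push_cast
    linear_combination UresT_rec m

/-- **`ũ_n = −8·Σ_k (−1)^k resRT n k`** for every `n` (same recursion (13), same initial values `ũ_0 = 0`, `ũ_1 = 6`).
[cite: Zudilin2002CatalanRemarks, Sect. 2, Theorem 2, eqs. (12)–(13)] -/
theorem uT_eq_UresT (n : ℕ) : uT n = UresT n := by
  have h := (solT_isSolutionT 0 6).ext_of_init UresT_isSolutionT (by simp [UresT_zero]) (by simp [UresT_one])
  exact congrFun h n

/-! ### `Ṽ_n := −Σ_k resRT n k·κ(k)` and its recursion up to the inhomogeneity `B̃_n` -/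

/-- `Ṽ_n := −Σ_{k=−n}^{n} resRT n k·κ(k)` with the tree's weight `κ = Remarks.kap` (`κ(k+2) − κ(k) = 16/(2k+1)²`,
`κ(0) = κ(1) = 0`). [cite: Zudilin2002CatalanRemarks, Sect. 2, eq. (12) with Sect. 1, eqs. (10)–(11)] -/
def VresT (n : ℕ) : ℚ := -wsum n (fun k => resRT n k * kap k)

/-- Any window `|k| ≤ N`, `N ≥ n`, computes `Ṽ_n`. [cite: Zudilin2002CatalanRemarks, Sect. 2, eq. (12)] -/
theorem VresT_window (n N : ℕ) (hN : n ≤ N) : -wsum N (fun k => resRT n k * kap k) = VresT n := by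
  unfold VresT
  congr 1
  refine wsum_of_support n _ (fun k hk => ?_) N hN
  rcases hk with hk | hk
  · rw [resRT_eq_zero_of_gt n k (by omega), zero_mul]
  · rw [resRT_eq_zero_of_lt n k (by omega), zero_mul]

/-- The inhomogeneity `B̃_n := Σ_{k} telT n k/(1−P_k)²` (window `|k| ≤ n+1` ⊇ support; `= −S̃_n′(1)`; it vanishes for
`n ≥ 2`, see `CatalanRemarksVTIdentification.BsumT_eq_zero`). [cite: Zudilin2002CatalanRemarks, Sect. 2, Theorem 2] -/
def BsumT (n : ℕ) : ℚ := wsum (n + 1) (fun k => telT n k / (1 - pole k) ^ 2)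

/-- **`Ṽ` solves (13) up to `B̃`**: at index `n = m+2`,
`A(n)Ṽ_{n+1} − q̃(n)Ṽ_n − C(n)Ṽ_{n−1} = B̃_n` (sum the certificate identity against `κ`; Abel summation moves the shift
onto `κ`, whose second difference step is `1/(1−P_k)²`). [cite: Zudilin2002CatalanRemarks, Sect. 2, Theorem 2, eq. (13)] -/
theorem VresT_rec (m : ℕ) :
    (2 * ((m : ℚ) + 2)) ^ 2 * (2 * ((m : ℚ) + 2) + 1) ^ 2 * pT ((m : ℚ) + 2) * VresT (m + 3)
      - qT ((m : ℚ) + 2) * VresT (m + 2)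
      - (2 * ((m : ℚ) + 2)) ^ 2 * (2 * ((m : ℚ) + 2) + 1) * (2 * ((m : ℚ) + 2) - 3) * pT ((m : ℚ) + 2 + 1)
          * VresT (m + 1) = BsumT (m + 2) := by
  rw [← VresT_window (m + 3) (m + 3) le_rfl, ← VresT_window (m + 2) (m + 3) (by omega),
    ← VresT_window (m + 1) (m + 3) (by omega)]
  have key : (fun k => (2 * ((m : ℚ) + 2)) ^ 2 * (2 * ((m : ℚ) + 2) + 1) ^ 2 * pT ((m : ℚ) + 2)
        * (resRT (m + 3) k * kap k) - qT ((m : ℚ) + 2) * (resRT (m + 2) k * kap k)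
        - (2 * ((m : ℚ) + 2)) ^ 2 * (2 * ((m : ℚ) + 2) + 1) * (2 * ((m : ℚ) + 2) - 3) * pT ((m : ℚ) + 2 + 1)
          * (resRT (m + 1) k * kap k))
      = fun k => (fun j => telT (m + 2) j * kap (j - 2)) (k + 2) - telT (m + 2) k * kap k := by
    funext k
    simp only [add_sub_cancel_right]
    linear_combination kap k * dataIdentityT m k
  have step : (2 * ((m : ℚ) + 2)) ^ 2 * (2 * ((m : ℚ) + 2) + 1) ^ 2 * pT ((m : ℚ) + 2)
        * -wsum (m + 3) (fun k => resRT (m + 3) k * kap k)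
      - qT ((m : ℚ) + 2) * -wsum (m + 3) (fun k => resRT (m + 2) k * kap k)
      - (2 * ((m : ℚ) + 2)) ^ 2 * (2 * ((m : ℚ) + 2) + 1) * (2 * ((m : ℚ) + 2) - 3) * pT ((m : ℚ) + 2 + 1)
        * -wsum (m + 3) (fun k => resRT (m + 1) k * kap k)
      = -(wsum (m + 3) (fun k => (fun j => telT (m + 2) j * kap (j - 2)) (k + 2))
          - wsum (m + 3) (fun k => telT (m + 2) k * kap k)) := by
    rw [← wsum_sub, ← key, ← wsum_lin3]
    ring
  rw [step, wsum_shift_two (m + 3) (by omega) (fun j => telT (m + 2) j * kap (j - 2)), ← wsum_sub, wsum_neg]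
  · unfold BsumT wsum
    rw [show m + 2 + 1 = m + 3 by ring]
    refine Finset.sum_congr rfl fun j _ => ?_
    beta_reduce
    rw [div_eq_mul_one_div, ← kap_sub]
    ring
  · exact mul_eq_zero_of_left (telT_eq_zero_of_gt (m + 2) _ (by push_cast; omega)) _
  · exact mul_eq_zero_of_left (telT_eq_zero_of_gt (m + 2) _ (by push_cast; omega)) _
  · exact mul_eq_zero_of_left (telT_eq_zero_of_le (m + 2) _ (by push_cast; omega)) _
  · exact mul_eq_zero_of_left (telT_eq_zero_of_le (m + 2) _ (by push_cast; omega)) _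

end Summit.KontsevichZagierPeriods.Zeta5Search.CatalanRemarksVT
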